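import Summits.Ventures.LatticeQCDFlow.Scaling.DominatedStarTimeAverages
import Summits.Ventures.LatticeQCDFlow.Scaling.DominatedStarRetunedConstants

/-!
HONEST FRAMING: exact (Metropolis-corrected) sampling algorithms for lattice gauge theory; figures
of merit are autocorrelation/cost numbers at stated couplings and volumes; no continuum-physics
claim.

# DominatedStarAutocorrelationCeiling — THE INTEGRATED AUTOCORRELATION TIME OF EVERY OBSERVABLE UNDER THE
# MAP-ASSISTED HOT-REFRESHED HUB: ONE-SIDED DOMINATION `p·μ_l(φ_r u) ≤ μ_0(u)` AND `4t ≤ p(1−t)w_0` GIVE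
# `v(g) ≤ (4m/(tcp) − 1)·Var_π̃(g)`, I.E. `τ_int(g) = v(g)/(2Var_π̃(g)) ≤ 2m/(tcp) − ½`; AT THE SWAP-ODDS WEIGHT
# `τ_int(g) ≤ m/(tc(p − 2t/h)) − ½` (`h = (1−t)w_0`, `2t < ph`); PERFECT TRANSPORTS `τ_int(g) ≤ (m(t+h)+tc)/(tch) − ½`
# (lean-2 GEN-26, ours)

Venture-side (OURS).  Cell `lqcd-flow` (pub-lqcd), unit `pub-lqcd-lean-2-g26`, 2026-08-27.  Chapter M, file 20 — the
cell's figure of merit.  `v(g) = asympVar g π̃ P = lim N·Var(N⁻¹Σ_{s<N} g(X_s))` is the asymptotic variance of the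
ergodic average of `g` under the STATIONARY scheme and `τ_int(g) = v(g)/(2Var_π̃(g))` its integrated autocorrelation time
(convention of `Scaling/ColdReplicaAutocorrelation`, chapter K, where the FLOORS `τ_int ≥ 2m·μ_k(A)μ_k(Aᶜ)/(t·deg(k)) − ½`
for idle cold replicas were proved).  The ceiling is the reversible bound `v(g) ≤ (2/γ − 1)·Var_π̃(g)`
(`AsymptoticVarianceSpectral.asympVar_le_spectralGap`, in the tree) fed with `γ ≥ γ⋆` for the irreducible reversible
scheme and the absolute-gap floors of `Scaling/DominatedStarGapAndMixing` / `Scaling/DominatedStarRetunedConstants`.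

## What is proved

* §0 (any finite chain) **`asympVar_le_of_absSpectralGap_ge`** — reversible, irreducible, `|X| ≥ 2`, `0 < a ≤ γ⋆`:
  `v(g) ≤ (2/a − 1)·Var_π(g)`; **`tauInt_le_of_absSpectralGap_ge`** — `v(g)/(2Var_π(g)) ≤ 1/a − ½`.
* §1 **`dominatedStar_asympVar_le`**, **`dominatedStar_tauInt_le`** — `|S| ≥ 2`, one-sided domination,
  `4t ≤ p(1−t)w_0`, `0 < t`, reversible cold kernels: `v(g) ≤ (2/(tcp/(2m)) − 1)·Var_π̃(g)`,
  **`τ_int(g) ≤ 1/(tcp/(2m)) − ½`** for EVERY observable `g` of the configuration.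
* §2 **`oddsStar_tauInt_le`** — `2t < p(1−t)w_0`: `τ_int(g) ≤ 1/(tc(p − 2t/((1−t)w_0))/m) − ½`;
  **`bestPerfectStar_tauInt_le`** — perfect maps, `0 < t < 1`, `w_0 > 0`:
  `τ_int(g) ≤ 1/(tc(1−t)w_0/(t(m+c) + (1−t)w_0·m)) − ½`.

Reading (no numerics implied): for a flow-assisted parallel-tempering hub whose learned transports dominate
one-sidedly with constant `p`, the statistical cost of the exact (Metropolis-corrected) estimator of ANY observable is
certified: per effective sample at most `2τ_int ≤ 4m/(tcp)` sweeps of the scheme in the regime `4t ≤ p(1−t)w_0`, and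
`≈ 2m/(tcp)` at small swap odds — order `K/(tp)` at `m = cK`; chapter K's floors say a cold replica that must tunnel
through the hub pays at least `2m·μ_k(A)μ_k(Aᶜ)/(t·c_k)`.  NOT CLAIMED: observables of the trajectory other than
ergodic averages; the metastable regime without domination; anything measured.  Literature grade (cell rule): OWN
RESULT on the tree's `asympVar_le_spectralGap` (Madras–Slade / Levin–Peres–Wilmer spectral bound); nothing cited as a
fact; no new bib keys.
-/

noncomputable section

open Finset Function
open Literature.Probability.MarkovChains

namespace Summit.Ventures.LatticeQCDFlow.Scaling

/-! ## §0 Asymptotic variance from an absolute-gap floor -/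

/-- **`0 < a ≤ γ⋆` ⇒ `v(g) ≤ (2/a − 1)·Var_π(g)`** for a reversible irreducible chain on `|X| ≥ 2` points. [ours] -/
theorem asympVar_le_of_absSpectralGap_ge {X : Type*} [Fintype X] [DecidableEq X] [Nontrivial X] {P : Matrix X X ℝ}
    {π : X → ℝ} (hπ : ∀ x, 0 < π x) (hπ1 : ∑ x, π x = 1) (hP : IsRowStochastic P) (hDB : DetailedBalance π P)
    (hirr : Literature.Probability.MarkovChains.IsIrreducible P) {a : ℝ} (ha : 0 < a) (hgap : a ≤ absSpectralGap P)
    (g : X → ℝ) : asympVar g π P ≤ (2 / a - 1) * lawVariance π g := by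
  have hγ : a ≤ spectralGap π P := hgap.trans (absSpectralGap_le_spectralGap hπ hπ1 hP hDB hirr)
  have hV : 0 ≤ lawVariance π g := lawVariance_nonneg (fun x => (hπ x).le) g
  refine (asympVar_le_spectralGap hπ hπ1 hP hDB hirr g).trans (mul_le_mul_of_nonneg_right ?_ hV)
  have : 2 / spectralGap π P ≤ 2 / a := div_le_div_of_nonneg_left (by norm_num) ha hγ
  linarith

/-- **`0 < a ≤ γ⋆` ⇒ `τ_int(g) = v(g)/(2Var_π(g)) ≤ 1/a − ½`** (reversible, irreducible, `|X| ≥ 2`; when `Var_π(g) = 0`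
the left side is `0`). [ours] -/
theorem tauInt_le_of_absSpectralGap_ge {X : Type*} [Fintype X] [DecidableEq X] [Nontrivial X] {P : Matrix X X ℝ}
    {π : X → ℝ} (hπ : ∀ x, 0 < π x) (hπ1 : ∑ x, π x = 1) (hP : IsRowStochastic P) (hDB : DetailedBalance π P)
    (hirr : Literature.Probability.MarkovChains.IsIrreducible P) {a : ℝ} (ha : 0 < a) (ha1 : a ≤ 1)
    (hgap : a ≤ absSpectralGap P) (g : X → ℝ) :
    asympVar g π P / (2 * lawVariance π g) ≤ 1 / a - 1 / 2 := by
  have hV : 0 ≤ lawVariance π g := lawVariance_nonneg (fun x => (hπ x).le) g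
  have hrhs : 0 ≤ 1 / a - 1 / 2 := by
    have : 1 ≤ 1 / a := by rw [le_div_iff₀ ha]; linarith
    linarith
  rcases hV.eq_or_lt with hV0 | hVpos
  · rw [← hV0, mul_zero, div_zero]; exact hrhs
  · rw [div_le_iff₀ (by positivity)]
    have h := asympVar_le_of_absSpectralGap_ge hπ hπ1 hP hDB hirr ha hgap g
    have e : (1 / a - 1 / 2) * (2 * lawVariance π g) = (2 / a - 1) * lawVariance π g := by ring
    rw [e]; exact h

variable {S : Type*} [Fintype S] [DecidableEq S] {K m : ℕ} {μ : Fin (K + 1) → S → ℝ} {M : Fin (K + 1) → S → S → ℝ}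
  {w : Fin (K + 1) → ℝ} {t p : ℝ}

section TauInt
variable (κ : Fin m → Fin K) (φ : Fin m → Equiv.Perm S)

/-! ## §1 Chapter M's regime -/

/-- **THE ASYMPTOTIC VARIANCE OF EVERY OBSERVABLE: `v(g) ≤ (2/(tcp/(2m)) − 1)·Var_π̃(g)`** under one-sided domination,
`4t ≤ p(1−t)w_0`, `0 < t`, exact hot sampler, reversible cold kernels, `|S| ≥ 2`. [ours] -/
theorem dominatedStar_asympVar_le [Nontrivial S] (hm : 1 ≤ m) (ht0 : 0 < t) (ht1 : t ≤ 1) (hw0 : ∀ k, 0 ≤ w k)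
    (hw1 : ∑ k, w k = 1) (hμ : ∀ k x, 0 < μ k x) (hμ1 : ∀ k, ∑ u, μ k u = 1) (hM : ∀ k, IsRowStochastic (M k))
    (hMrev : ∀ k, DetailedBalance (μ k) (M k)) (hM0 : ∀ u v, M 0 u v = μ 0 v) (hp0 : 0 < p) (hp1 : p ≤ 1)
    (hdom : ∀ r u, p * μ (κ r).succ (φ r u) ≤ μ 0 u) (hreg : 4 * t ≤ p * (1 - t) * w 0)
    {c : ℕ} (hc1 : 1 ≤ c) (hc : ∀ p' : Fin K, c ≤ (univ.filter (fun r : Fin m => κ r = p')).card) (hcm : c ≤ m)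
    (g : (Fin (K + 1) → S) → ℝ) :
    asympVar g (tensorFun μ) (fun y z : Fin (K + 1) → S =>
        t * ptGraphSwap μ (fun r : Fin m => (((0 : Fin (K + 1)), (κ r).succ) : Fin (K + 1) × Fin (K + 1))) φ y z
          + (1 - t) * prodKernel w M y z)
      ≤ (2 / (t * c * p / (2 * m)) - 1) * lawVariance (tensorFun μ) g := by
  have hmpos : (0 : ℝ) < m := Nat.cast_pos.mpr (by omega)
  have hcpos : (0 : ℝ) < c := Nat.cast_pos.mpr (by omega)
  have hP := weightedScheme_isRowStochastic (t := t) (w := w)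
    (ptGraphSwap_isRowStochastic (e := fun r : Fin m => (((0 : Fin (K + 1)), (κ r).succ) : Fin (K + 1) × Fin (K + 1)))
      (φ := φ) hμ) hM hw0 hw1 ht0.le ht1
  exact asympVar_le_of_absSpectralGap_ge (fun z => tensorFun_pos hμ z) (sum_tensorFun_eq_one _ hμ1) hP
    (dominatedStar_detailedBalance κ φ hμ hMrev)
    (dominatedStar_isIrreducible κ φ hm ht0 ht1 hw0 hw1 hμ hμ1 hM hMrev hM0 hp0 hp1 hdom hreg hc1 hc hcm) (by positivity)
    (dominatedStar_absSpectralGap_ge κ φ hm ht0.le ht1 hw0 hw1 hμ hμ1 hM hMrev hM0 hp0 hp1 hdom hreg hc1 hc hcm) g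

/-- **THE INTEGRATED AUTOCORRELATION TIME OF EVERY OBSERVABLE: `τ_int(g) ≤ 1/(tcp/(2m)) − ½`** (`= 2m/(tcp) − ½`) under
one-sided domination and `4t ≤ p(1−t)w_0`. [ours] -/
theorem dominatedStar_tauInt_le [Nontrivial S] (hm : 1 ≤ m) (ht0 : 0 < t) (ht1 : t ≤ 1) (hw0 : ∀ k, 0 ≤ w k)
    (hw1 : ∑ k, w k = 1) (hμ : ∀ k x, 0 < μ k x) (hμ1 : ∀ k, ∑ u, μ k u = 1) (hM : ∀ k, IsRowStochastic (M k))
    (hMrev : ∀ k, DetailedBalance (μ k) (M k)) (hM0 : ∀ u v, M 0 u v = μ 0 v) (hp0 : 0 < p) (hp1 : p ≤ 1)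
    (hdom : ∀ r u, p * μ (κ r).succ (φ r u) ≤ μ 0 u) (hreg : 4 * t ≤ p * (1 - t) * w 0)
    {c : ℕ} (hc1 : 1 ≤ c) (hc : ∀ p' : Fin K, c ≤ (univ.filter (fun r : Fin m => κ r = p')).card) (hcm : c ≤ m)
    (g : (Fin (K + 1) → S) → ℝ) :
    asympVar g (tensorFun μ) (fun y z : Fin (K + 1) → S =>
        t * ptGraphSwap μ (fun r : Fin m => (((0 : Fin (K + 1)), (κ r).succ) : Fin (K + 1) × Fin (K + 1))) φ y z
          + (1 - t) * prodKernel w M y z) / (2 * lawVariance (tensorFun μ) g)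
      ≤ 1 / (t * c * p / (2 * m)) - 1 / 2 := by
  have hmpos : (0 : ℝ) < m := Nat.cast_pos.mpr (by omega)
  have hcpos : (0 : ℝ) < c := Nat.cast_pos.mpr (by omega)
  have hcm' : (c : ℝ) ≤ m := by exact_mod_cast hcm
  have hP := weightedScheme_isRowStochastic (t := t) (w := w)
    (ptGraphSwap_isRowStochastic (e := fun r : Fin m => (((0 : Fin (K + 1)), (κ r).succ) : Fin (K + 1) × Fin (K + 1)))
      (φ := φ) hμ) hM hw0 hw1 ht0.le ht1
  have ha1 : t * c * p / (2 * m) ≤ 1 := by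
    rw [div_le_one (by positivity)]
    have h1 : t * c ≤ 1 * m := by nlinarith
    nlinarith
  exact tauInt_le_of_absSpectralGap_ge (fun z => tensorFun_pos hμ z) (sum_tensorFun_eq_one _ hμ1) hP
    (dominatedStar_detailedBalance κ φ hμ hMrev)
    (dominatedStar_isIrreducible κ φ hm ht0 ht1 hw0 hw1 hμ hμ1 hM hMrev hM0 hp0 hp1 hdom hreg hc1 hc hcm) (by positivity)
    ha1 (dominatedStar_absSpectralGap_ge κ φ hm ht0.le ht1 hw0 hw1 hμ hμ1 hM hMrev hM0 hp0 hp1 hdom hreg hc1 hc hcm) g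

/-! ## §2 The retuned weights -/

/-- **AT THE SWAP-ODDS WEIGHT (`2t < p(1−t)w_0`): `τ_int(g) ≤ 1/(tc(p − 2t/((1−t)w_0))/m) − ½`** for every
observable `g` (`|S| ≥ 2`, reversible cold kernels).  In this wider regime irreducibility is read off the retuned
ceiling itself: `d(n) → 0` forces `Pⁿ(x,z) ≥ π̃(z) − d(n) > 0` at a large time. [ours] -/
theorem oddsStar_tauInt_le [Nontrivial S] (hm : 1 ≤ m) (ht0 : 0 < t) (ht1 : t < 1) (hw0 : ∀ k, 0 ≤ w k)
    (hw00 : 0 < w 0) (hw1 : ∑ k, w k = 1) (hμ : ∀ k x, 0 < μ k x) (hμ1 : ∀ k, ∑ u, μ k u = 1)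
    (hM : ∀ k, IsRowStochastic (M k)) (hMrev : ∀ k, DetailedBalance (μ k) (M k)) (hM0 : ∀ u v, M 0 u v = μ 0 v)
    (hp0 : 0 < p) (hp1 : p ≤ 1) (hdom : ∀ r u, p * μ (κ r).succ (φ r u) ≤ μ 0 u) (hreg : 2 * t < p * ((1 - t) * w 0))
    {c : ℕ} (hc1 : 1 ≤ c) (hc : ∀ p' : Fin K, c ≤ (univ.filter (fun r : Fin m => κ r = p')).card) (hcm : c ≤ m)
    (g : (Fin (K + 1) → S) → ℝ) :
    asympVar g (tensorFun μ) (fun y z : Fin (K + 1) → S =>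
        t * ptGraphSwap μ (fun r : Fin m => (((0 : Fin (K + 1)), (κ r).succ) : Fin (K + 1) × Fin (K + 1))) φ y z
          + (1 - t) * prodKernel w M y z) / (2 * lawVariance (tensorFun μ) g)
      ≤ 1 / (t * c * (p - 2 * t / ((1 - t) * w 0)) / m) - 1 / 2 := by
  have hstat : ∀ k : Fin (K + 1), k ≠ 0 → ∀ v, ∑ u, μ k u * M k u v = μ k v :=
    fun k _ v => (hMrev k).isStationary (hM k).2 v
  have hmpos : (0 : ℝ) < m := Nat.cast_pos.mpr (by omega)
  have hcpos : (0 : ℝ) < c := Nat.cast_pos.mpr (by omega)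
  have hcm' : (c : ℝ) ≤ m := by exact_mod_cast hcm
  have hh : 0 < (1 - t) * w 0 := mul_pos (by linarith) hw00
  have hb0 : 0 < 2 * t / ((1 - t) * w 0) := div_pos (by linarith) hh
  have hbp : 2 * t / ((1 - t) * w 0) < p := by rw [div_lt_iff₀ hh]; linarith
  have hP := weightedScheme_isRowStochastic (t := t) (w := w)
    (ptGraphSwap_isRowStochastic (e := fun r : Fin m => (((0 : Fin (K + 1)), (κ r).succ) : Fin (K + 1) × Fin (K + 1)))
      (φ := φ) hμ) hM hw0 hw1 ht0.le ht1.le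
  have ha0 : 0 < t * c * (p - 2 * t / ((1 - t) * w 0)) / m := by
    have : 0 < p - 2 * t / ((1 - t) * w 0) := by linarith
    positivity
  have ha1 : t * c * (p - 2 * t / ((1 - t) * w 0)) / m ≤ 1 := by
    rw [div_le_one hmpos]
    have h1 : p - 2 * t / ((1 - t) * w 0) ≤ 1 := by linarith
    have h2 : c * (p - 2 * t / ((1 - t) * w 0)) ≤ m * 1 := by nlinarith
    nlinarith
  -- irreducibility from the retuned minorisation: some power is everywhere positive
  have hirr : Literature.Probability.MarkovChains.IsIrreducible (fun y z : Fin (K + 1) → S =>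
      t * ptGraphSwap μ (fun r : Fin m => (((0 : Fin (K + 1)), (κ r).succ) : Fin (K + 1) × Fin (K + 1))) φ y z
        + (1 - t) * prodKernel w M y z) := by
    -- the retuned ceiling gives `d(n) → 0`, hence `Pⁿ(x,z) ≥ π̃(z) − d(n) > 0` at a large time
    have hd := retunedStar_worstTvDist_le κ φ hm ht0.le ht1.le hw0 hw1 hμ hμ1 hM hM0 hstat hp0 hp1 hdom hb0 hbp.le
      (by rw [mul_div_cancel₀ _ hh.ne']) hc hcm
    -- pick `n` with `C·ρⁿ < min_z π̃(z)` and use the event bound `Pⁿ(x,{z}) ≥ π̃(z) − ‖Pⁿ(x,·) − π̃‖_TV`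
    obtain ⟨zmin, -, hzmin⟩ := Finset.exists_min_image univ (tensorFun μ) (univ_nonempty)
    have hπmin : 0 < tensorFun μ zmin := tensorFun_pos hμ zmin
    have hρ1 : 1 - t * c * (p - 2 * t / ((1 - t) * w 0)) / m < 1 := by linarith
    have hC : 0 < ((K : ℝ) + 2 * t / ((1 - t) * w 0)) / (2 * t / ((1 - t) * w 0)) := by positivity
    obtain ⟨n, hn⟩ := exists_pow_lt_of_lt_one (div_pos hπmin hC) hρ1
    have hlt : ((K : ℝ) + 2 * t / ((1 - t) * w 0)) / (2 * t / ((1 - t) * w 0))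
        * (1 - t * c * (p - 2 * t / ((1 - t) * w 0)) / m) ^ n < tensorFun μ zmin := by
      have h1 := mul_lt_mul_of_pos_left hn hC
      rwa [mul_div_cancel₀ _ hC.ne'] at h1
    refine isIrreducible_of_kernelAt_pos (n := n) fun x z => ?_
    have hst : IsStationary (tensorFun μ) (fun y z : Fin (K + 1) → S =>
        t * ptGraphSwap μ (fun r : Fin m => (((0 : Fin (K + 1)), (κ r).succ) : Fin (K + 1) × Fin (K + 1))) φ y z
          + (1 - t) * prodKernel w M y z) := dominatedStar_isStationary κ φ ht0.le ht1.le hw0 hw1 hμ hM hMrev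
    have hmass : ∑ z', lawAt (fun y z : Fin (K + 1) → S =>
        t * ptGraphSwap μ (fun r : Fin m => (((0 : Fin (K + 1)), (κ r).succ) : Fin (K + 1) × Fin (K + 1))) φ y z
          + (1 - t) * prodKernel w M y z) (Pi.single x 1) n z' = ∑ z', tensorFun μ z' := by
      rw [sum_lawAt hP, Finset.sum_pi_single', if_pos (mem_univ _), sum_tensorFun_eq_one μ hμ1]
    have hev := sub_sum_le_tvDist hmass.symm {z}
    rw [Finset.sum_singleton, Finset.sum_singleton, tvDist_comm] at hev
    have htv := (tvDist_single_le_worstTvDist _ (tensorFun μ) n x).trans (hd n)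
    have hzle := hzmin z (mem_univ z)
    unfold kernelAt
    linarith
  exact tauInt_le_of_absSpectralGap_ge (fun z => tensorFun_pos hμ z) (sum_tensorFun_eq_one _ hμ1) hP
    (dominatedStar_detailedBalance κ φ hμ hMrev) hirr ha0 ha1
    (oddsStar_absSpectralGap_ge κ φ hm ht0 ht1 hw0 hw00 hw1 hμ hμ1 hM hMrev hM0 hp0 hp1 hdom hreg hc1 hc hcm) g

/-- **PERFECT TRANSPORTS AT THE BEST WEIGHT: `τ_int(g) ≤ 1/(tc(1−t)w_0/(t(m+c) + (1−t)w_0·m)) − ½`** (`0 < t < 1`,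
`w_0 > 0`, reversible cold kernels, `|S| ≥ 2`). [ours] -/
theorem bestPerfectStar_tauInt_le [Nontrivial S] (hm : 1 ≤ m) (ht0 : 0 < t) (ht1 : t < 1) (hw0 : ∀ k, 0 ≤ w k)
    (hw00 : 0 < w 0) (hw1 : ∑ k, w k = 1) (hμ : ∀ k x, 0 < μ k x) (hμ1 : ∀ k, ∑ u, μ k u = 1)
    (hM : ∀ k, IsRowStochastic (M k)) (hMrev : ∀ k, DetailedBalance (μ k) (M k)) (hM0 : ∀ u v, M 0 u v = μ 0 v)
    (hperf : ∀ r u, μ (κ r).succ (φ r u) = μ 0 u) {c : ℕ} (hc1 : 1 ≤ c)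
    (hc : ∀ p' : Fin K, c ≤ (univ.filter (fun r : Fin m => κ r = p')).card) (hcm : c ≤ m)
    (g : (Fin (K + 1) → S) → ℝ) :
    asympVar g (tensorFun μ) (fun y z : Fin (K + 1) → S =>
        t * ptGraphSwap μ (fun r : Fin m => (((0 : Fin (K + 1)), (κ r).succ) : Fin (K + 1) × Fin (K + 1))) φ y z
          + (1 - t) * prodKernel w M y z) / (2 * lawVariance (tensorFun μ) g)
      ≤ 1 / (t * c * ((1 - t) * w 0) / (t * ((m : ℝ) + c) + (1 - t) * w 0 * m)) - 1 / 2 := by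
  have hstat : ∀ k : Fin (K + 1), k ≠ 0 → ∀ v, ∑ u, μ k u * M k u v = μ k v :=
    fun k _ v => (hMrev k).isStationary (hM k).2 v
  have hmpos : (0 : ℝ) < m := Nat.cast_pos.mpr (by omega)
  have hcpos : (0 : ℝ) < c := Nat.cast_pos.mpr (by omega)
  have hcm' : (c : ℝ) ≤ m := by exact_mod_cast hcm
  have hh : 0 < (1 - t) * w 0 := mul_pos (by linarith) hw00
  have hw01 : w 0 ≤ 1 := by
    have h := Finset.single_le_sum (f := w) (fun k _ => hw0 k) (mem_univ (0 : Fin (K + 1)))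
    rw [hw1] at h; exact h
  have hP := weightedScheme_isRowStochastic (t := t) (w := w)
    (ptGraphSwap_isRowStochastic (e := fun r : Fin m => (((0 : Fin (K + 1)), (κ r).succ) : Fin (K + 1) × Fin (K + 1)))
      (φ := φ) hμ) hM hw0 hw1 ht0.le ht1.le
  have ha0 : 0 < t * c * ((1 - t) * w 0) / (t * ((m : ℝ) + c) + (1 - t) * w 0 * m) := by positivity
  have ha1 : t * c * ((1 - t) * w 0) / (t * ((m : ℝ) + c) + (1 - t) * w 0 * m) ≤ 1 := by
    rw [div_le_one (by positivity)]
    have h1 : (1 - t) * w 0 ≤ 1 := by nlinarith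
    have h2 : t * c * ((1 - t) * w 0) ≤ t * c * 1 := mul_le_mul_of_nonneg_left h1 (by positivity)
    nlinarith [mul_nonneg hh.le hmpos.le]
  -- irreducibility: the perfect case satisfies one-sided domination with `p = 1`; use the separation minorisation of
  -- `Scaling/DominatedStarSeparation` (no regime condition for perfect maps)
  have hirr : Literature.Probability.MarkovChains.IsIrreducible (fun y z : Fin (K + 1) → S =>
      t * ptGraphSwap μ (fun r : Fin m => (((0 : Fin (K + 1)), (κ r).succ) : Fin (K + 1) × Fin (K + 1))) φ y z
        + (1 - t) * prodKernel w M y z) := by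
    have hKp : 0 < 2 * ((K : ℝ) + 1) := by positivity
    have hρ1 : 1 - t * (1 - t) * w 0 * c / (2 * m) < 1 := by
      have : 0 < t * (1 - t) * w 0 * c / (2 * m) := by positivity
      linarith
    obtain ⟨n, hn⟩ := exists_pow_lt_of_lt_one (div_pos one_pos hKp) hρ1
    have hlt : 2 * ((K : ℝ) + 1) * (1 - t * (1 - t) * w 0 * c / (2 * m)) ^ n < 1 := by
      have h1 := mul_lt_mul_of_pos_left hn hKp
      rwa [mul_div_cancel₀ _ hKp.ne'] at h1
    refine isIrreducible_of_kernelAt_pos (n := n) fun x z => ?_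
    have hge := perfectStar_kernelAt_ge κ φ hm ht0 ht1 hw0 hw00 hw1 hμ hμ1 hM hM0 hstat hperf hc1 hc hcm n x z
    exact lt_of_lt_of_le (mul_pos (by linarith) (tensorFun_pos hμ z)) hge
  exact tauInt_le_of_absSpectralGap_ge (fun z => tensorFun_pos hμ z) (sum_tensorFun_eq_one _ hμ1) hP
    (dominatedStar_detailedBalance κ φ hμ hMrev) hirr ha0 ha1
    (bestPerfectStar_absSpectralGap_ge κ φ hm ht0 ht1 hw0 hw00 hw1 hμ hμ1 hM hMrev hM0 hperf hc1 hc hcm) g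

end TauInt

end Summit.Ventures.LatticeQCDFlow.Scaling

end
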